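import Mathlib
import Summits.Ventures.HodgeRepro.Tier4.Line4.TailLayerCake
import Summits.Ventures.HodgeRepro.Tier4.Line4.TailBound

/-!
# Tier4/Line4/TailLayerCakeFibre — the tail of the geometric side OFF A FINITE SET OF ORBITS: the main term as the sum
over the fibre of the invariant, the threshold asked off the fibre only

Blind re-derivation cell `pub-hodge-repro`, Tier 4 «PROVE THE STEP», LINE L4, seat t4-x2 (g4, reserve wall-breaker),
lead (R-27) S15050 on L1-p3's finding S15043: the coset sparsity (S1) — in the point form `R ≤ d (t⁻¹ γ t′)` on the
support outside `o₀` — holds only OFF the fibre `{o : I(o) = I(o₀)}` of the `T × T′`-invariant `I`; the orbits locally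
conjugate to `γ₀` need not leave.  THIS MODULE generalises TailLayerCake's `norm_J_sub_orbital_le` from `{o₀}` to a
FINITE set `F` of orbits (the fibre, finite by the fibre bound; `{o₀}` on the regular locus): the main term becomes
`∑_{o ∈ F} O_o(f)`, the threshold is asked on the rational points whose orbit is NOT in `F`, and the bound is the same
(the characters as `IsCharacter` / `IsCharacter'`, the binders of TailBound).
Tree path `lean/Summits/Ventures/HodgeRepro/Tier4/Line4/TailLayerCakeFibre.lean`.  0 print, no `def`.

* `tsum_orbits_eq_sum_partialKernel` — `∑'_{γ : orbitOf γ ∈ F} f (x⁻¹ γ y) = ∑_{o ∈ F} K_f^o(x, y)` (indicators of the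
  fibres of `orbitOf`, `tsum_subtype` and `Summable.tsum_finsetSum`).
* `kernel_sub_sum_partialKernel_eq_tsum`, `norm_kernel_sub_sum_partialKernel_le` — `K_f − ∑_{o ∈ F} K_f^o` is the tail
  sum over the rational points off `F`, bounded by the threshold layer-cake.
* `norm_J_sub_sum_orbital_le`, `exists_norm_J_sub_sum_orbital_le_family` — the bounds of TailLayerCake §4 with
  `∑_{o ∈ F} O_o` in place of `O_{o₀}` and the threshold off `F` (`integral_finsetSum` twice on KernelL1's per-orbit
  integrability, then the two `integral_sub`s).

Nothing here says anything about the status of the Hodge conjecture for CM abelian varieties, which is NOT proved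
(HC_CM is NOT proved by anyone in this repository).
-/

set_option autoImplicit false

noncomputable section

namespace Summit.Ventures.HodgeRepro.Tier4.Line4

open MeasureTheory Topology Filter Summit.Ventures.HodgeRepro.Tier4.Common
  Summit.Ventures.HodgeRepro.Tier4.Line1 Summit.Ventures.HodgeRepro.Tier4.Line1.RTF

/-! ## 1. The kernel minus the partial kernels of a finite set of orbits -/

section Kernel

variable {G : Type} [Group G] [TopologicalSpace G] [MeasurableSpace G] (S : Setting G)

/-- `∑'_{γ : orbitOf γ ∈ F} f (x⁻¹ γ y) = ∑_{o ∈ F} K_f^o(x, y)` for an absolutely summable family: both sides are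
`∑'_γ 1[orbitOf γ ∈ F] f (x⁻¹ γ y)` (`tsum_subtype`, the finite sum of indicators of the fibres is the indicator of
their union, `Summable.tsum_finsetSum`). -/
theorem tsum_orbits_eq_sum_partialKernel {f : G → ℂ} {x y : G}
    (hs : Summable (fun γ : S.Gk => ‖f (x⁻¹ * γ * y)‖)) (F : Finset S.Orbit) :
    ∑' γ : ({γ : S.Gk | S.orbitOf γ ∈ F} : Set S.Gk), f (x⁻¹ * γ.1 * y) =
      ∑ o ∈ F, S.partialKernel o f x y := by
  classical
  have hsum : Summable (fun γ : S.Gk => f (x⁻¹ * γ * y)) := hs.of_norm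
  have h1 : ∀ o : S.Orbit, S.partialKernel o f x y =
      ∑' γ : S.Gk, ({γ : S.Gk | S.orbitOf γ = o} : Set S.Gk).indicator (fun γ : S.Gk => f (x⁻¹ * γ * y)) γ :=
    fun o => tsum_subtype {γ : S.Gk | S.orbitOf γ = o} (fun γ : S.Gk => f (x⁻¹ * γ * y))
  have hf : ∀ o ∈ F, Summable (fun γ : S.Gk =>
      ({γ : S.Gk | S.orbitOf γ = o} : Set S.Gk).indicator (fun γ : S.Gk => f (x⁻¹ * γ * y)) γ) :=
    fun o _ => hsum.indicator _
  rw [tsum_subtype {γ : S.Gk | S.orbitOf γ ∈ F} (fun γ : S.Gk => f (x⁻¹ * γ * y))]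
  simp_rw [h1]
  rw [← Summable.tsum_finsetSum hf]
  refine tsum_congr fun γ => ?_
  simp only [Set.indicator_apply, Set.mem_setOf_eq, Finset.sum_ite_eq]

/-- `K_f(x, y) − ∑_{o ∈ F} K_f^o(x, y) = ∑'_{γ : orbitOf γ ∉ F} f (x⁻¹ γ y)`. -/
theorem kernel_sub_sum_partialKernel_eq_tsum {f : G → ℂ} {x y : G}
    (hs : Summable (fun γ : S.Gk => ‖f (x⁻¹ * γ * y)‖)) (F : Finset S.Orbit) :
    S.kernel f x y - ∑ o ∈ F, S.partialKernel o f x y =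
      ∑' γ : ({γ : S.Gk | S.orbitOf γ ∈ F}ᶜ : Set S.Gk), f (x⁻¹ * γ.1 * y) := by
  have h := hs.of_norm.tsum_subtype_add_tsum_subtype_compl {γ : S.Gk | S.orbitOf γ ∈ F}
  rw [tsum_orbits_eq_sum_partialKernel S hs F] at h
  rw [sub_eq_iff_eq_add']
  exact h.symm

/-- `‖K_f(x, y) − ∑_{o ∈ F} K_f^o(x, y)‖ ≤ C · C′ e^α e^{−(β−α)R} (1 − e^{α−β})⁻¹` when every support point off `F` at
`(x, y)` has size `≥ R`. -/
theorem norm_kernel_sub_sum_partialKernel_le (f : G → ℂ) (d : G → ℝ) (hd : ∀ z, 0 ≤ d z) {C α β C' R : ℝ}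
    (hC : 0 ≤ C) (hαβ : α < β) (hβ : 0 ≤ β) (hC' : 0 ≤ C') (hdecay : ∀ z, ‖f z‖ ≤ C * Real.exp (-(β * d z)))
    (x y : G)
    (hcnt : ∀ T : ℝ, ∃ s : Finset S.Gk, (∀ γ : S.Gk, f (x⁻¹ * γ * y) ≠ 0 → d (x⁻¹ * γ * y) ≤ T → γ ∈ s) ∧
      (s.card : ℝ) ≤ C' * Real.exp (α * T))
    (F : Finset S.Orbit) (hR : ∀ γ : S.Gk, S.orbitOf γ ∉ F → f (x⁻¹ * γ * y) ≠ 0 → R ≤ d (x⁻¹ * γ * y)) :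
    ‖S.kernel f x y - ∑ o ∈ F, S.partialKernel o f x y‖ ≤
      C * (C' * Real.exp α * Real.exp (-((β - α) * R)) * (1 - Real.exp (α - β))⁻¹) := by
  have hs : Summable (fun γ : S.Gk => ‖f (x⁻¹ * γ * y)‖) :=
    summable_of_sum_le (fun _ => norm_nonneg _)
      (sum_norm_le_of_decay_count S f d hd hC hαβ hβ hC' hdecay x y hcnt)
  rw [kernel_sub_sum_partialKernel_eq_tsum S hs F]
  exact norm_tsum_tail_le_of_decay_count_threshold S f d hC hαβ hβ hC' hdecay x y hcnt _
    (fun γ hγ => hR γ hγ)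

end Kernel

/-! ## 2. The tail bound `‖J(f) − ∑_{o ∈ F} O_o(f)‖` — L4-p2's `norm_J_sub_sum_le` (TailBound p702085) fed with the
threshold tail -/

section Geometric

variable {G : Type} [Group G] [TopologicalSpace G] [IsTopologicalGroup G] [MeasurableSpace G] [BorelSpace G]
  (S : Setting G) [SecondCountableTopology G]

/-- **The tail of the geometric side off a finite set of orbits**: `‖J(f) − ∑_{o ∈ F} O_o(f)‖ ≤ C · C′ e^α e^{−(β−α)R}
(1 − e^{α−β})⁻¹ · μ_{T′}(D_{T′}) · μ_T(D_T)` when every rational point whose orbit is not in `F` and which meets the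
support at `(t, t′) ∈ cl D_T × cl D_{T′}` has size `≥ R` (the coset sparsity OFF the fibre `F`); `C′` is the count
constant of the compact pair `cl D_T × cl D_{T′}`.  L4-p2's `norm_J_sub_sum_le` (the regrouping over the fibres and
the two integrations) with the threshold tail of TailLayerCake as its `hM`. -/
theorem norm_J_sub_sum_orbital_le (f : G → ℂ) (hf : Continuous f) (d : G → ℝ) (hd : ∀ z, 0 ≤ d z) {C α β : ℝ}
    (hC : 0 ≤ C) (hαβ : α < β) (hβ : 0 ≤ β) (hdecay : ∀ z, ‖f z‖ ≤ C * Real.exp (-(β * d z)))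
    (P : G → Prop) (hsupp : ∀ z, f z ≠ 0 → P z)
    (hcount : ∀ C₁ C₂ : Set G, IsCompact C₁ → IsCompact C₂ → ∃ C' : ℝ, 0 ≤ C' ∧ ∀ x ∈ C₁, ∀ y ∈ C₂, ∀ T : ℝ,
      ∃ s : Finset S.Gk, (∀ γ : S.Gk, P (x⁻¹ * γ * y) → d (x⁻¹ * γ * y) ≤ T → γ ∈ s) ∧
        (s.card : ℝ) ≤ C' * Real.exp (α * T))
    {χ : S.T → ℂ} (hχ : S.IsCharacter χ) {χ' : S.T' → ℂ} (hχ' : S.IsCharacter' χ') (F : Finset S.Orbit) {R : ℝ}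
    (hR : ∀ t ∈ closure S.DT, ∀ t' ∈ closure S.DT', ∀ γ : S.Gk, S.orbitOf γ ∉ F →
      f ((t : G)⁻¹ * γ * t') ≠ 0 → R ≤ d ((t : G)⁻¹ * γ * t')) :
    ∃ C' : ℝ, 0 ≤ C' ∧ ‖S.J χ χ' f - ∑ o ∈ F, S.orbital χ χ' o f‖ ≤
      C * (C' * Real.exp α * Real.exp (-((β - α) * R)) * (1 - Real.exp (α - β))⁻¹) *
        S.μT'.real S.DT' * S.μT.real S.DT := by
  have hcount' : ∀ C₁ C₂ : Set G, IsCompact C₁ → IsCompact C₂ → ∃ C' : ℝ, 0 ≤ C' ∧ ∀ x ∈ C₁, ∀ y ∈ C₂, ∀ T : ℝ,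
      ∃ s : Finset S.Gk, (∀ γ : S.Gk, f (x⁻¹ * γ * y) ≠ 0 → d (x⁻¹ * γ * y) ≤ T → γ ∈ s) ∧
        (s.card : ℝ) ≤ C' * Real.exp (α * T) := by
    intro C₁ C₂ hC₁ hC₂
    obtain ⟨C', hC'0, h⟩ := hcount C₁ C₂ hC₁ hC₂
    refine ⟨C', hC'0, fun x hx y hy T => ?_⟩
    obtain ⟨s, hs, hcard⟩ := h x hx y hy T
    exact ⟨s, fun γ hne hdT => hs γ (hsupp _ hne) hdT, hcard⟩
  have hP : L1Class.PoincareSummable S f :=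
    poincareSummable_of_decay_count S f d hd hC hαβ hβ hdecay hcount'
  obtain ⟨C', hC'0, hcnt⟩ := hcount' ((fun t : S.T => (t : G)) '' closure S.DT)
    ((fun t : S.T' => (t : G)) '' closure S.DT') (S.compT.image continuous_subtype_val)
    (S.compT'.image continuous_subtype_val)
  refine ⟨C', hC'0, norm_J_sub_sum_le S hχ hχ' hf hP F fun t ht t' ht' => ?_⟩
  exact (summable_norm_tail_of_decay_count_threshold S f d hC hαβ hβ hC'0 hdecay _ _
    (hcnt _ ⟨t, ht, rfl⟩ _ ⟨t', ht', rfl⟩) {γ : S.Gk | S.orbitOf γ ∈ (F : Set S.Orbit)ᶜ}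
    (fun γ hγ hne => hR t ht t' ht' γ hγ hne)).2

/-- **The family form off a finite set of orbits**: ONE constant `K` with `‖J(f N) − ∑_{o ∈ F} O_o(f N)‖ ≤ K · e^{−(β−α) g N}`
for every `N`, from decay, region and count uniform in `N` and the threshold `g N` on the support off `F`. -/
theorem exists_norm_J_sub_sum_orbital_le_family (f : ℕ → G → ℂ) (hf : ∀ N, Continuous (f N)) (d : G → ℝ)
    (hd : ∀ z, 0 ≤ d z) {C α β : ℝ} (hC : 0 ≤ C) (hαβ : α < β) (hβ : 0 ≤ β)
    (hdecay : ∀ N z, ‖f N z‖ ≤ C * Real.exp (-(β * d z)))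
    (P : G → Prop) (hsupp : ∀ N z, f N z ≠ 0 → P z)
    (hcount : ∀ C₁ C₂ : Set G, IsCompact C₁ → IsCompact C₂ → ∃ C' : ℝ, 0 ≤ C' ∧ ∀ x ∈ C₁, ∀ y ∈ C₂, ∀ T : ℝ,
      ∃ s : Finset S.Gk, (∀ γ : S.Gk, P (x⁻¹ * γ * y) → d (x⁻¹ * γ * y) ≤ T → γ ∈ s) ∧
        (s.card : ℝ) ≤ C' * Real.exp (α * T))
    {χ : S.T → ℂ} (hχ : S.IsCharacter χ) {χ' : S.T' → ℂ} (hχ' : S.IsCharacter' χ') (F : Finset S.Orbit)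
    (g : ℕ → ℝ)
    (hR : ∀ N, ∀ t ∈ closure S.DT, ∀ t' ∈ closure S.DT', ∀ γ : S.Gk, S.orbitOf γ ∉ F →
      f N ((t : G)⁻¹ * γ * t') ≠ 0 → g N ≤ d ((t : G)⁻¹ * γ * t')) :
    ∃ K : ℝ, 0 ≤ K ∧ ∀ N, ‖S.J χ χ' (f N) - ∑ o ∈ F, S.orbital χ χ' o (f N)‖ ≤
      K * Real.exp (-((β - α) * g N)) := by
  obtain ⟨C', hC'0, hcnt⟩ := hcount ((fun t : S.T => (t : G)) '' closure S.DT)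
    ((fun t : S.T' => (t : G)) '' closure S.DT') (S.compT.image continuous_subtype_val)
    (S.compT'.image continuous_subtype_val)
  refine ⟨C * (C' * Real.exp α * (1 - Real.exp (α - β))⁻¹) * S.μT'.real S.DT' * S.μT.real S.DT, ?_, fun N => ?_⟩
  · have hr1 : Real.exp (α - β) < 1 := by
      rw [Real.exp_lt_one_iff]
      linarith
    have : 0 ≤ (1 - Real.exp (α - β))⁻¹ := inv_nonneg.2 (by linarith)
    positivity
  · have hcountN : ∀ C₁ C₂ : Set G, IsCompact C₁ → IsCompact C₂ → ∃ C'' : ℝ, 0 ≤ C'' ∧ ∀ x ∈ C₁, ∀ y ∈ C₂,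
        ∀ T : ℝ, ∃ s : Finset S.Gk, (∀ γ : S.Gk, f N (x⁻¹ * γ * y) ≠ 0 → d (x⁻¹ * γ * y) ≤ T → γ ∈ s) ∧
          (s.card : ℝ) ≤ C'' * Real.exp (α * T) := by
      intro C₁ C₂ hC₁ hC₂
      obtain ⟨C'', hC''0, h⟩ := hcount C₁ C₂ hC₁ hC₂
      refine ⟨C'', hC''0, fun x hx y hy T => ?_⟩
      obtain ⟨s, hs, hcard⟩ := h x hx y hy T
      exact ⟨s, fun γ hne hdT => hs γ (hsupp N _ hne) hdT, hcard⟩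
    have hP : L1Class.PoincareSummable S (f N) :=
      poincareSummable_of_decay_count S (f N) d hd hC hαβ hβ (hdecay N) hcountN
    have hM : ∀ t ∈ closure S.DT, ∀ t' ∈ closure S.DT',
        ∑' γ : {γ : S.Gk // S.orbitOf γ ∈ (F : Set S.Orbit)ᶜ}, ‖f N ((t : G)⁻¹ * γ.1 * t')‖ ≤
          C * (C' * Real.exp α * Real.exp (-((β - α) * g N)) * (1 - Real.exp (α - β))⁻¹) := by
      intro t ht t' ht'
      have hcnt' : ∀ T : ℝ, ∃ s : Finset S.Gk,
          (∀ γ : S.Gk, f N ((t : G)⁻¹ * γ * t') ≠ 0 → d ((t : G)⁻¹ * γ * t') ≤ T → γ ∈ s) ∧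
            (s.card : ℝ) ≤ C' * Real.exp (α * T) := by
        intro T
        obtain ⟨s, hs, hcard⟩ := hcnt _ ⟨t, ht, rfl⟩ _ ⟨t', ht', rfl⟩ T
        exact ⟨s, fun γ hne hdT => hs γ (hsupp N _ hne) hdT, hcard⟩
      exact (summable_norm_tail_of_decay_count_threshold S (f N) d hC hαβ hβ hC'0 (hdecay N) _ _ hcnt'
        {γ : S.Gk | S.orbitOf γ ∈ (F : Set S.Orbit)ᶜ} (fun γ hγ hne => hR N t ht t' ht' γ hγ hne)).2
    have h := norm_J_sub_sum_le S hχ hχ' (hf N) hP F hM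
    refine h.trans (le_of_eq ?_)
    ring

end Geometric

end Summit.Ventures.HodgeRepro.Tier4.Line4

end
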